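import Mathlib
import HarnessLib
import HarnessLib.Audit
import Summits.Schanuel.Statement
import Literature.ModelTheory.ExponentialFields.ExponentialField
import HarnessLib.Audit.Status.Attr

/-!
Route: RootDecomp1C

# Route RootDecomp1C — root decomposition OR-sibling C (lens-6 ConjugationCarving) — Schanuel ⟺
AxisSchanuel ⟸ RealSchanuel ∧ UnitarySchanuel ∧ MixedInductionStep (carve ℂ_exp along complex
conjugation)

DECOMPOSITION WORKSHOP `decomp-schanuel` (D-0170/0171/0172), ROOT node N4 = lens-6
«ConjugationCarving» (OR-sibling of route-Schanuel-RootDecomp1 =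
N1 EssentialDimension and route-Schanuel-RootDecomp1B = N3 PolarSymmetrisation); NOTHING IN THIS
FILE PROVES SCHANUEL. Target = the ROOT statement
verbatim, `_root_.Schanuel := Literature.Periods.SchanuelConjecture`. ONE EQUIV layer: Schanuel ⟺
AxisSchanuel (Schanuel for AXIS tuples — every
coordinate real or purely imaginary), by σ-symmetrisation (σ = complex conjugation, exp ∘ σ = σ ∘
exp): for V = span_ℚ x take axis bases w of V + σV
(length p) and c of V ∩ σV (length p′); p + p′ = 2n (modularity of dim_ℚ) and 2n ≤ trdeg ℚ(w, e^w) +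
trdeg ℚ(c, e^c) ≤ trdeg F + trdeg F_c ≤
trdeg F_x̄ + trdeg F_x = 2·trdeg F_x (submodularity of trdeg + σ-invariance), F = ℚ(x, x̄, e^x,
e^x̄) — KERNEL-CERTIFIED BOTH WAYS in the lens file
(`schanuel_iff_axisSchanuel`, 0 sorry, axioms std) and rendered here as the PROVABLE support binder
`AxisReduction : AxisSchanuel → Schanuel`
(closed as soon as the lens's Theorems-ready extract ConjugationSymmetrisation.lean lands). Beneath
it the EXACT AND split AxisSchanuel ⟺ X with
X = RealSchanuel ∧ UnitarySchanuel ∧ MixedInductionStep (`axisSchanuel_iff_pieces`, strong induction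
on the length): RealSchanuel = SC_ℝ (= item
stmt-Schanuel-19278), UnitarySchanuel = Schanuel on the imaginary axis (lens-4 typing, = item
stmt-Schanuel-24624 of RootDecomp1B; lens-6's
`CircleSchanuel` ∀ z with re z = 0 is the same statement — the adapter t ↦ (t : ℂ)·I is inside
`closes`), MixedInductionStep = «no MIXED FIRST FAILURE among
axis tuples»: Schanuel for a genuinely mixed axis tuple GIVEN Schanuel for all shorter axis tuples
of every signature. `closes : AxisReduction →
RealSchanuel → UnitarySchanuel → MixedInductionStep → Schanuel` is PROVED (writer sketch
c6/Sketch.lean rc 0, 0 sorry: SC_ℝ transported along the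
E-field embedding ℝ ↪ ℂ `ExponentialRingHom.realComplex.lift_trdeg_adjoin_eq`, the imaginary case
through the injective ℚ-linear map t ↦ (t : ℂ)·I,
the mixed case by the binder with the induction hypothesis; then AxisReduction); all four binders
load-bearing; necessity S ⟹ each piece proved in
the sketch (`realSchanuel_of_schanuel` via `schanuelProperty_real_of_complex_holds`,
`unitarySchanuel_of_schanuel`, `mixedInductionStep_of_schanuel`,
`axisReduction_of_schanuel`). WORKSHOP RECORD: lens package HOME/decomp-schanuel-lens-6/ (HOME =
run/shared/lean/pub/decomp-schanuel):
ConjugationCarving.lean sha256=2a7b88948048f7d37f30d5b982561b193f37a9882aac11d94f257bccec072bdc (v2;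
critic-checked v1 c53cdeea…), ConjugationSymmetrisation.lean
(Theorems-ready EQUIV extract)
sha256=5038e8d996496d5b4061a89e4533cd8f83ab59a012c701635c906d4a5f725b59, NODE.md
sha256=3baff5ef7a0a0c6de168f9027aa4b7bb9a0367b66df66b774d17cfb53399263e,
bc7_probe.lean sha256=b29f054498e9a05ffc9aa6ae8533d2430222d1d41bfdcdb685b5e5a094b39aa5 (NODE lines
decomp-schanuel-lens-6-g0 2026-08-30T01:38:22Z v1, 01:42:01Z v2;
RESULT/DONE 01:42:01Z). Critic decomp-schanuel-crit-1 VERDICT 2026-08-30T01:40:14Z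
(HOME/CRITIC-LEDGER.md row 5) CLEARED and 01:43:44Z (re-issue for v2, code
diff 0 lines) CLEARED: «EQUIV S ⟺ AxisSchanuel kernel-certified both ways — proves lens-4
ConjStableReduction too; split R ∧ C ∧ M exact by strong induction;
padding blocked by the GLOBAL induction hypothesis; M is a first-failure piece (vacuous above the
minimal failing length) — ‹absolute› overstated but
admissible; R, C, M each load-bearing; flag: 0 open ATTACKABLE conjuncts». Per-piece tags (critic):
AxisSchanuel = EQUIV PROVED (land now) → here the
target item + the provable binder AxisReduction · leaf ATTACKABLE (landing); RealSchanuel = WEAKER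
(= stmt-19278; shared with P1 RealCoreRotationSplit and
RootDecomp1B) · IDEA-NEEDED; UnitarySchanuel (lens-6: CircleSchanuel) = WEAKER (≡ lens-4
UnitarySchanuel — ONE item) · IDEA-NEEDED; MixedInductionStep =
WEAKER(evidence, no separating model; first-failure piece) · IDEA-NEEDED · (1,1)-cell
INSTRUMENTABLE(consistency); no COSTUME piece among the open binders,
no UNDECIDED piece. Census data file: HOME/census/COSTUME-CENSUS-v1.json
sha256=a603904cc9f5a585d6a2725f299620915226d8cd08a43fab428793937abdad14 (124 rows;
row EQ7 «conj-symmetrisation EQUIV: none kernel-certified both ways» — this node certifies it; rows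
D3/T10 RealSchanuel blind sectors); lens-6 census
REQUEST 01:38:22Z (PSLQ boxes at (1,iπ), (log 2,iπ), (iπ,i), (1,e)) open, no data yet. WHY NOVEL: no
Theses file, negative or census row of this summit cuts
ℂ_exp along the eigenspaces of complex conjugation; every certified split on record pairs «S on a
sector Σ» with a RELATIVE Schanuel over Σ, whereas
here pieces 1–2 are absolute classical statements (SC_ℝ, SC_iℝ) and piece 3 is a first-failure step
with no relative clause, under an EQUIV that is
kernel-certified both ways for the first time (census EQ7).
Lean: `(Literature.ModelTheory.ExponentialFields.SchanuelProperty ℝ) ∧ (∀ (m : ℕ) (r : Fin m → ℝ),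
LinearIndependent ℚ r → (m : Cardinal) ≤ Algebra.trdeg ℚ ↥(IntermediateField.adjoin ℚ (Set.range
(fun j => ((r j : ℝ) : ℂ) * Complex.I) ∪ Set.range (Complex.exp ∘ fun j => ((r j : ℝ) : ℂ) *
Complex.I)))) ∧ (∀ (n : ℕ) (z : Fin n → ℂ), (∀ j, (z j).im = 0 ∨ (z j).re = 0) → (∃ j, (z j).im ≠ 0)
→ (∃ j, (z j).re ≠ 0) → (∀ (m : ℕ) (w : Fin m → ℂ), m < n → (∀ j, (w j).im = 0 ∨ (w j).re = 0) →
LinearIndependent ℚ w → (m : Cardinal) ≤ Algebra.trdeg ℚ ↥(IntermediateField.adjoin ℚ (Set.range w ∪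
Set.range (Complex.exp ∘ w)))) → LinearIndependent ℚ z → (n : Cardinal) ≤ Algebra.trdeg ℚ
↥(IntermediateField.adjoin ℚ (Set.range z ∪ Set.range (Complex.exp ∘ z))))`

## Assembly
Inside `closes` (c6/glue.lean, 0 sorry, ≈ 55 lines): (i) SC_ℝ transported into ℂ along ℝ ↪ ℂ
(`ExponentialRingHom.realComplex.lift_trdeg_adjoin_eq`,
`Cardinal.lift_id`); (ii) strong induction on the length n of an axis tuple: all coordinates real ⇒
z = (a : ℂ) with a ℚ-l.i. (pull back along the
ℚ-linear map t ↦ (t : ℂ), `LinearIndependent.of_comp`) ⇒ (i); all coordinates imaginary ⇒ z = (b :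
ℂ)·I with b ℚ-l.i. (pull back along t ↦ (t : ℂ)·I)
⇒ UnitarySchanuel; otherwise MixedInductionStep with the induction hypothesis; this gives
AxisSchanuel; (iii) AxisReduction. Cone = 4 binders (3 cruxes +
1 provable support), glue uses AxisSchanuel; necessity arrows and `assembly_holds` in the writer
sketch.

Rationale: WHY THIS LINE. Conjugating one number of a tuple is the classical conjugation method (Diaz1989; D.
Diaz, J. Théor. Nombres Bordeaux 16 (2004),
doi:10.5802/jtnb.459, Conjecture C(|u|) and Prop. 1; Waldschmidt2000 Ch. 1); applied to the whole
ℚ-span of a putative counterexample it yields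
an unconditional normal form at NO cost in the defect: Schanuel's conjecture is equivalent to its
restriction to axis tuples (kernel-certified,
lens-6). On axis tuples the statement splits by TYPE: pure real tuples = SC_ℝ, the Schanuel property
of the real exponential field
(MacintyreWilkie1996: decidability of ℝ_exp under SC_ℝ; KirbyZilber2006: uniform SC_ℝ), pure
imaginary tuples = Schanuel on iℝ (values of
cos, sin at ℚ-free real arguments; contains π ⊥ e^i and Lindemann–Weierstrass at algebraic imaginary
tuples), and genuinely MIXED tuples, where
the content is an induction step over all shorter axis tuples (its n = 2 instance over the
Hermite–Lindemann floor is e ⊥ π outright; Nesterenko1996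
proves the (π√d, iπ) cells). Imported from elsewhere: only field theory (tower law, submodularity of
trdeg, Mathlib `IntermediateField.lift_trdeg_add_eq`
+ base change) and the E-field embedding ℝ ↪ ℂ (tree
`Literature.ModelTheory.ExponentialFields.ExponentialRingHom.realComplex`). Lens-6 reading
(barrier-complement carving): piece 1 lies OUTSIDE the hypotheses of the kernel-driven no-go
mechanisms by construction — B8 (i)
`not_schanuelProperty_of_kernel_relation` and B9 (iii) `kzTuple` need a non-zero kernel element, and
ker(Real.exp) = 0 (lens file
`realExp_kernel_trivial`, `realSchanuel_no_kernel_witness`); the kernel 2πiℤ lies inside piece 2's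
domain (`cexp_kernel_on_imaginary_axis`).
Relation to the OR-sibling RootDecomp1B (lens-4): both conj-stabilise; lens-4 then PADS to the polar
diagonal (r, i r) and keeps ONE coupled residual
PolarCoupling; here real and imaginary parts stay independent (V + σV = A ⊕ iB, no padding) and the
coupling is an induction step over ALL shorter
axis tuples of every signature (k, m); the two routes SHARE the items RealSchanuel (19278) and
UnitarySchanuel (24624), and lens-4's support binder
ConjStableReduction follows from this node's certified EQUIV.

RANKED CRUXES. #0 AxisSchanuel (target) — EQUIV LAYER / TARGET X⁺ — Schanuel's conjecture for AXIS
tuples: for z : Fin n → ℂ with every coordinate real or purely imaginary and ℚ-linearly independent,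
n ≤ trdeg ℚ(z, e^z). Equivalent to the ROOT: S ⟹ AxisSchanuel by restriction (sketch
`axisSchanuel_of_schanuel`); AxisSchanuel ⟹ S = the support binder AxisReduction (σ-symmetrisation,
kernel-certified in the lens file `schanuel_of_axisSchanuel`). TAG: EQUIV, COSTUME(cite: lens file
`schanuel_iff_axisSchanuel`, census EQ7) — admissible as the ONE language layer because the split
beneath (pieces 1–3) is WEAKER (critic G4 ✓). Used by `closes` as the intermediate (`have hAxis :
AxisSchanuel`). [difficulty: open-problem] (why it might fail: it fails iff Schanuel fails
(certified equivalence); as an item it is closed by AxisReduction and the three pieces, never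
attacked directly.) [Diaz1989, Waldschmidt2000]
#2 MixedInductionStep (crux) — PIECE 3 (deciding; critic: a FIRST-FAILURE piece) — NO MIXED FIRST
FAILURE AMONG AXIS TUPLES: for an axis tuple z : Fin n → ℂ (every coordinate real or purely
imaginary) with at least one non-real and at least one non-imaginary coordinate, if every shorter
ℚ-linearly independent axis tuple w (any signature) satisfies m ≤ trdeg ℚ(w, e^w), and z is
ℚ-linearly independent, then n ≤ trdeg ℚ(z, e^z). Equivalently S ⟺ NoPureFailure (pieces 1 ∧ 2) ∧
NoMixedFirstFailure (this piece). At n = 2 the induction hypothesis is Hermite–Lindemann, so the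
piece contains e ⊥ π (z = (1, iπ)) and log 2 ⊥ π OUTRIGHT; proved cells: (π√d, iπ) (Nesterenko1996).
TAG WEAKER(evidence: S ⟹ it by dropping the hypotheses, sketch `mixedInductionStep_of_schanuel`;
converse unknown — silent on every pure cell ((1, e), (log 2, log 3), (iπ, i)); BC7 P5 C → S not
closed (lens bc7_probe 4/4 CLEAN); the GLOBAL induction hypothesis (all shorter axis tuples
anywhere) blocks cost-≤ 1 padding r ↦ (r, iπ), iθ ↦ (iθ, log 2) — critic 01:40:14Z; honest price:
under ¬S with minimal failing axis length n₀ the piece is VACUOUS above n₀, i.e. it is a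
first-failure piece, and no separating model is known (critic: WEAKER(evidence, no separating
model))). NECESSARY (G1 ✓). LEAF: IDEA-NEEDED (an attack must name non-derivation input: B11 makes
Ax-type arguments vacuous at a first failure; the named non-soft input of the node is ℂ = ℝ ⊕ iℝ
with σ continuous and modulus one on the unit circle) + (1,1)-cell INSTRUMENTABLE(consistency only:
PSLQ boxes at (1, iπ), (log 2, iπ), census REQUEST 01:38:22Z). [difficulty: open-problem] (why it
might fail: false iff the shortest axis counterexample to Schanuel is genuinely mixed — e.g. an
algebraic relation between e and π (z = (1, iπ), n = 2, induction hypothesis = Hermite–Lindemann);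
nothing known excludes it.) [Nesterenko1996, Waldschmidt2000, Lang1966]
#3 UnitarySchanuel (crux) — PIECE 2 — SCHANUEL ON THE IMAGINARY AXIS / THE UNIT CIRCLE (lens-4
typing, = item stmt-Schanuel-24624 of route-Schanuel-RootDecomp1B; lens-6's `CircleSchanuel` «for
ℚ-l.i. purely imaginary z, n ≤ trdeg ℚ(z, e^z)» is the same statement, adapter t ↦ (t : ℂ)·I inside
`closes`): for ℚ-linearly independent real r : Fin m → ℝ, m ≤ trdeg ℚ(i r, exp(i r)); equivalently
trdeg ℚ(θ, cos θ, sin θ) ≥ m for ℚ-free real θ. Contains π ⊥ e^i (cell (iπ, i)) and π ⊥ (−1)^√2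
(cell (iπ, iπ√2)); proved cells: rank 1 (Hermite–Lindemann), Lindemann–Weierstrass at ℚ-l.i.
algebraic imaginary tuples. TAG WEAKER(evidence: S ⟹ it by restriction, sketch
`unitarySchanuel_of_schanuel`; converse unknown — blind to every tuple meeting ℝ∖0: (1, e), (log 2,
log 3) (rotation x ↦ ix does not transport e^x) and to (1, iπ); padding an imaginary tuple keeps it
imaginary only with imaginary entries, so no cost-≤ 1 padding reaches S; BC7 P5 not closed; critic
01:37:55Z / 01:40:14Z). NECESSARY (G1 ✓). LEAF: IDEA-NEEDED (inside the ceilings B1 — logarithms of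
algebraic numbers of modulus 1 —, B3, B6; structural handle for ideation: values on the compact
torus U(1), θ ↦ (cos θ, sin θ) restricted-analytic / ℝ_an-definable on bounded ranges; this piece
CARRIES the kernel 2πiℤ, so B8/B9 are ABOUT its domain but refute only E-field-uniform / first-order
derivations, not the statement) + INSTRUMENTABLE(consistency: PSLQ box at (iπ, i)). [difficulty:
open-problem] (why it might fail: false iff some ℚ-free real θ has trdeg ℚ(θ, cos θ, sin θ) < m,
e.g. an algebraic relation between π and e^i = cos 1 + i sin 1; open, no counterexample known.)
[Waldschmidt2000, Baker1975, Nesterenko1996]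
#4 RealSchanuel (crux) — PIECE 1 — SC_ℝ, the Schanuel property of the real exponential field (=
`Literature.ModelTheory.ExponentialFields.SchanuelProperty ℝ` verbatim = item stmt-Schanuel-19278,
shared with route-Schanuel-RealCoreRotationSplit and route-Schanuel-RootDecomp1B): for ℚ-linearly
independent real x : Fin n → ℝ, n ≤ trdeg ℚ(x, e^x). Contains e ⊥ e^e (cell (1, e)) and algebraic
independence of real logarithms (cell (log 2, log 3)); proved cells: Lindemann–Weierstrass at
algebraic real tuples. TAG WEAKER(evidence: S ⟹ SC_ℝ tree `schanuelProperty_real_of_complex_holds`;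
converse unknown in print — MacintyreWilkie1996 / KirbyZilber2006 keep SC_ℝ a separate hypothesis;
blind to every tuple meeting iℝ: (1, iπ) = e ⊥ π, (iπ, i); census rows D3/T10; BC7 P5 not closed).
NECESSARY (G1 ✓). LEAF: IDEA-NEEDED (lens-6: OUTSIDE the hypotheses of B8 (i) and B9 (iii) by
construction — ker Real.exp = 0; inside the technique ceilings B1/B3/B4/B6; o-minimal handle: ℝ_exp
is o-minimal and, under SC_ℝ, decidable) + INSTRUMENTABLE(consistency: PSLQ box at (1, e)).
[difficulty: open-problem] (why it might fail: false iff some ℚ-free real tuple has trdeg ℚ(x, e^x)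
< n, e.g. e and e^e algebraically dependent; open since Lang 1966 (real case), no counterexample
known.) [MacintyreWilkie1996, KirbyZilber2006, Waldschmidt2000, Lang1966]
#9 AxisReduction (support) — SUPPORT BINDER (load-bearing; PROVABLE NOW — proved sorry-free in the
lens file, `schanuel_of_axisSchanuel`, ≈ 400 lines: σ = conj as a ℚ-algebra map,
`exists_axis_tuple_of_conj_stable` (a conj-stable finite-dimensional ℚ-subspace of ℂ is spanned by
an axis tuple), `Submodule.finrank_sup_add_finrank_inf_eq`, trdeg submodularity from
`IntermediateField.lift_trdeg_add_eq` + base change): AxisSchanuel → Schanuel. It is the nontrivial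
direction of the EQUIV layer; it closes when
HOME/decomp-schanuel-lens-6/ConjugationSymmetrisation.lean (sha256 5038e8d9…, namespace
Summit.Schanuel.Schanuel.Theorems.ConjugationSymmetrisation, rc 0, 0 sorry) is landed as
Summits/Schanuel/Schanuel/Theorems/ConjugationSymmetrisation.lean proving `theorem … :
RootDecomp1C.AxisReduction` (critic hygiene note 01:43:44Z: tag or inline the AxisSchanuel def there
to avoid the vendored-fact lint). S ⟹ AxisReduction trivially. TAG: support · leaf ATTACKABLE
(landing task; it also yields RootDecomp1B's ConjStableReduction). [difficulty: provable-now]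
[Diaz1989, Waldschmidt2000]

TWO-LAYER PLAN. Foreseen glued splits (not filed now): AxisReduction ⇐ ConjStableAxisBasis
(`exists_axis_tuple_of_conj_stable`: a σ-stable finite-dimensional ℚ-subspace
of ℂ has an axis basis) → TrdegSubmodular (trdeg ℚ(X ∪ Y) + trdeg ℚ(X ∩ Y) ≤ trdeg ℚ X + trdeg ℚ Y)
→ AxisReduction (k = 2, depth 1) — only if the
Theorems landing of the lens extract stalls; otherwise AxisReduction closes in one file.
MixedInductionStep by signature (k, m) = (#real, #imaginary)
is NOT a glued split (the induction hypothesis ranges over all signatures); its (1,1)-cell «trdeg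
ℚ(a, ib, e^a, exp(ib)) ≥ 2 for a, b ∈ ℝ∖0» (contains
e ⊥ π) may be filed as a support RUNG once the census box exists.

KILL CRITERIA. A refutation of RealSchanuel, UnitarySchanuel or MixedInductionStep is a
counterexample to Schanuel's conjecture (each is S-implied, proved in the
sketch and the lens file): the route then closes refuted together with the summit. A refutation of
AxisReduction is impossible modulo mis-typing (it
is kernel-proved in the lens file over the same statements); a typing slip would be repaired by
restating, not by closing. The node is MOOTED if a
tribunal certifies MixedInductionStep ⟹ S or UnitarySchanuel ⟹ S cheaply (then the split is a
costume) — the recorded padding analysis (critic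
01:40:14Z) says the global induction hypothesis blocks the known cost-≤ 1 paddings.

NOT DECOMPOSED YET. RealSchanuel and UnitarySchanuel are named classical sub-conjectures left whole
(IDEA-NEEDED leaves); MixedInductionStep is left whole (first-failure
piece; its signature cells are rungs, not glue). The linear algebra inside AxisReduction (σ-stable
subspaces, axis bases, submodularity) is prover-level
and already written in the lens file.

CHEAPEST FALSIFIER. Of the LINE (not of S): (a) the BC7/BC2 probes `MixedInductionStep → Schanuel`,
`UnitarySchanuel → Schanuel`, `RealSchanuel → Schanuel` by
`exact? | simpa | aesop` — any success makes that piece ≡ S and the split a costume (lens bc7_probe: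
4/4 CLEAN, P5 not closed); (b) the padding test:
exhibit a cost-≤ 1 padding that turns a pure real or pure imaginary counterexample into a mixed
FIRST failure with the global induction hypothesis intact
(critic: blocked — the padded tuple's hypothesis contains the original counterexample); (c) for
AxisReduction: `lean check` of the lens extract
(rc 0, 0 sorry — done by lens and critic).

NUMBERS. σ-symmetrisation count: V = span_ℚ x of dim n, p = dim(V + σV), p′ = dim(V ∩ σV), p + p′ =
2n; 2n ≤ trdeg ℚ(w, e^w) + trdeg ℚ(c, e^c) ≤ 2·trdeg ℚ(x, e^x),
so an axis counterexample exists iff a counterexample exists, with NO loss in the defect (contrast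
RootDecomp1B's quarter-turn, which pads to the
diagonal). Items at open: 6 (1 target, 3 cruxes, 1 load-bearing support, 1 assembly); cone of closes
= 4 binders; shared items: RealSchanuel =
stmt-Schanuel-19278, UnitarySchanuel = stmt-Schanuel-24624. Flagship open cells per piece: piece 1
(1, e), (log 2, log 3); piece 2 (iπ, i), (iπ, iπ√2);
piece 3 (1, iπ), (log 2, iπ); proved: rank 1 (H–L), LW cells, (π√d, iπ) (Nesterenko1996).

DEFINITION REQUESTS. None: all statements are over Mathlib +
`Literature.ModelTheory.ExponentialFields.SchanuelProperty` (`lean search --decl` confirmed: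
`Literature.ModelTheory.ExponentialFields.SchanuelProperty`, `…ExponentialRingHom.realComplex`,
`…ExponentialRingHom.lift_trdeg_adjoin_eq`,
`…schanuelProperty_real_of_complex_holds`, `_root_.Schanuel`). Bib entry wanted (not blocking): Diaz
2004, doi:10.5802/jtnb.459.

Novelty: Searches (lens-6 and writer, 2026-08-30): lit search --hybrid "Schanuel conjecture complex
conjugation real imaginary parts reduction" / "conjugation
method Diaz Schanuel" (hits: Diaz 2004 doi:10.5802/jtnb.459 conjugation method for ONE number;
Waldschmidt2000 Ch. 1; none symmetrises the span);
lit vsearch "Schanuel's conjecture is equivalent to its restriction to tuples of real and purely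
imaginary numbers" (nearest [corpus:book-pila2022-point-counting-zilber-pink-conjecture p.125]
= uniform/real SC as separate hypotheses, no reduction); lit galaxy search "real Schanuel|Schanuel
conjecture for the reals|closed under complex conjugation"
--star all ([galaxy:pdf:697503260] den Besten 2020 thesis: uniform real SC à la Kirby–Zilber, no
reduction of SC to it; no Schanuel hit for the conjugation
needles); tree: lean search "realGraphSector|re_imI|conj" →
Theorems/SoloInformedRealGraphSector.lean (rank-two dictionary, bookkeeping), idea card
conjugation-discount-sigma-stable-core (the uncertified idea this node certifies), census EQ7;
ledger negatives --problem Schanuel: 6844 PolarSchanuel /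
6846 PhantomsAreTraceless are specialisation statements (B10), unrelated mechanism.
Nearest prior art found: doi:10.5802/jtnb.459 (Diaz 2004: uses ū with u for conditional/partial
results on one number; no equivalence of SC with an
axis-tuple statement); in tree route-Schanuel-RealCoreRotationSplit (shares SC_ℝ; its complement is
Schanuel RELATIVE to the real core ℚ(ecl_ℝ ∅)) and
the sibling ro  [refs: 10.5802/jtnb.459, doi:10.5802/jtnb.459, book-pila2022-point-counting-zilber-pink-conjecture, Waldschmidt2000]

Barriers (technique_class: decomposition, conjugation-symmetrisation, induction): - technique_class: decomposition, conjugation-symmetrisation, induction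
- Literature.Barriers.Schanuel.AxiomsDoNotForceSchanuel: B8 — its mechanism (i)
`not_schanuelProperty_of_kernel_relation` needs a transcendental kernel element; piece 1 (ℝ_exp) has
trivial kernel (lens `realExp_kernel_trivial`), so B8 has no instance on RealSchanuel; the kernel
lives in piece 2's domain, where B8 refutes E-field-uniform derivations, not the statement; no piece
is claimed to follow from E-field axioms.
- Literature.Barriers.Schanuel.SchanuelPropertyNotFirstOrder: B9 — no transfer/compactness is
invoked; (iii) `kzTuple` needs t ≠ 0 with exp t = 1, absent in ℝ_exp
(`realSchanuel_no_kernel_witness`); RealSchanuel is used as a hypothesis exactly as in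
Macintyre–Wilkie.
- Literature.Barriers.Schanuel.AlgebraicIndependenceOfLogarithms: it does not evade B1 and does not
claim to: RealSchanuel contains algebraic independence of real logarithms and UnitarySchanuel that
of logarithms of algebraic numbers of modulus 1; the bet is the carving, not a log method — hence
IDEA-NEEDED leaves.
- Literature.Barriers.Schanuel.LargeTranscendenceDegree: B3 caps the several-variables method at
trdeg ≈ dℓ/(d+ℓ); every piece at length ≥ 3 asks more; no evasion claimed (IDEA-NEEDED).
- Literature.Barriers.Schanuel.EFunctionValuesAtAlgebraicPoints: B4 — Siegel–Shidlovskii reaches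
only algebraic arguments (the LW cells of pieces 1–2, already proved); the open cells ((1, e), (iπ,
i), (1, iπ)) have transcendental argum

sub-problem: Schanuel · status: draft · opened planner-decomp-schanuel-writer-1-g0-0 2026-08-30T02:03:29Z · rev 0 · ledger route-Schanuel-RootDecomp1C
GENERATED by the gate from the ledger (D-0016/17). Provers cite these decls: `theorem foo : Summit.Schanuel.Schanuel.Theses.RootDecomp1C.<Decl> := …` in Summits/Schanuel/Schanuel/Theorems/<Name>.lean.
-/

namespace Summit.Schanuel.Schanuel.Theses.RootDecomp1C

open scoped BigOperators Topology Manifold Classical MeasureTheory ProbabilityTheory Matrix InnerProductSpace ComplexConjugate ContinuousMap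
open Filter Set Function TopologicalSpace MeasureTheory

attribute [summit_statement] _root_.Schanuel

open Literature.Periods

/-- item stmt-Schanuel-24786 · target · rank 0 · open · by planner
why it might fail: it fails iff Schanuel fails (certified equivalence); as an item it is closed by AxisReduction and the three pieces, never attacked directly.
sources: Diaz1989, Waldschmidt2000
[target] EQUIV LAYER / TARGET X⁺ — Schanuel's conjecture for AXIS tuples: for z : Fin n → ℂ with
every coordinate real or purely imaginary and ℚ-linearly independent, n ≤ trdeg ℚ(z, e^z).
Equivalent to the ROOT: S ⟹ AxisSchanuel by restriction (sketch `axisSchanuel_of_schanuel`);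
AxisSchanuel ⟹ S = the support binder AxisReduction (σ-symmetrisation, kernel-certified in the lens
file `schanuel_of_axisSchanuel`). TAG: EQUIV, COSTUME(cite: lens file `schanuel_iff_axisSchanuel`,
census EQ7) — admissible as the ONE language layer because the split beneath (pieces 1–3) is WEAKER
(critic G4 ✓). Used by `closes` as the intermediate (`have hAxis : AxisSchanuel`). [difficulty:
open-problem] -/
@[route_item "route-Schanuel-RootDecomp1C"]
def AxisSchanuel : Prop :=
  ∀ (n : ℕ) (z : Fin n → ℂ), (∀ j, (z j).im = 0 ∨ (z j).re = 0) → LinearIndependent ℚ z → (n : Cardinal) ≤ Algebra.trdeg ℚ ↥(IntermediateField.adjoin ℚ (Set.range z ∪ Set.range (Complex.exp ∘ z)))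

/-- item stmt-Schanuel-24787 · crux · leaf IDEA-NEEDED · rank 2 · open · by planner
why it might fail: false iff the shortest axis counterexample to Schanuel is genuinely mixed — e.g. an algebraic relation between e and π (z = (1, iπ), n = 2, induction hypothesis = Hermite–Lindemann); nothing known excludes it.
sources: Nesterenko1996, Waldschmidt2000, Lang1966
[crux] PIECE 3 (deciding; critic: a FIRST-FAILURE piece) — NO MIXED FIRST FAILURE AMONG AXIS TUPLES:
for an axis tuple z : Fin n → ℂ (every coordinate real or purely imaginary) with at least one
non-real and at least one non-imaginary coordinate, if every shorter ℚ-linearly independent axis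
tuple w (any signature) satisfies m ≤ trdeg ℚ(w, e^w), and z is ℚ-linearly independent, then n ≤
trdeg ℚ(z, e^z). Equivalently S ⟺ NoPureFailure (pieces 1 ∧ 2) ∧ NoMixedFirstFailure (this piece).
At n = 2 the induction hypothesis is Hermite–Lindemann, so the piece contains e ⊥ π (z = (1, iπ))
and log 2 ⊥ π OUTRIGHT; proved cells: (π√d, iπ) (Nesterenko1996). TAG WEAKER(evidence: S ⟹ it by
dropping the hypotheses, sketch `mixedInductionStep_of_schanuel`; converse unknown — silent on every
pure cell ((1, e), (log 2, log 3), (iπ, i)); BC7 P5 C → S not closed (lens bc7_probe 4/4 CLEAN); the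
GLOBAL induction hypothesis (all shorter axis tuples anywhere) blocks cost-≤ 1 padding r ↦ (r, iπ),
iθ ↦ (iθ, log 2) — critic 01:40:14Z; honest price: under ¬S with minimal failing axis length n₀ the
piece is VACUOUS above n₀, i.e. it is a first-failure piece, and no separating model is known
(critic: WEAKER(evide -/
@[route_item "route-Schanuel-RootDecomp1C", crux (bottleneck := idea) (source := "ledger D-0171 leaf tag IDEA-NEEDED on stmt-Schanuel-24787, 2026-09-01")]
def MixedInductionStep : Prop :=
  ∀ (n : ℕ) (z : Fin n → ℂ), (∀ j, (z j).im = 0 ∨ (z j).re = 0) → (∃ j, (z j).im ≠ 0) → (∃ j, (z j).re ≠ 0) → (∀ (m : ℕ) (w : Fin m → ℂ), m < n → (∀ j, (w j).im = 0 ∨ (w j).re = 0) → LinearIndependent ℚ w → (m : Cardinal) ≤ Algebra.trdeg ℚ ↥(IntermediateField.adjoin ℚ (Set.range w ∪ Set.range (Complex.exp ∘ w)))) → LinearIndependent ℚ z → (n : Cardinal) ≤ Algebra.trdeg ℚ ↥(IntermediateField.adjoin ℚ (Set.range z ∪ Set.range (Complex.exp ∘ z)))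

/-- item stmt-Schanuel-24624 · crux · leaf IDEA-NEEDED · rank 3 · open · by planner
why it might fail: false iff some ℚ-free real θ has trdeg ℚ(θ, cos θ, sin θ) < m, e.g. an algebraic relation between π and e^i = cos 1 + i sin 1; open, no counterexample known.
sources: Waldschmidt2000, Baker1975, Nesterenko1996
[crux] Schanuel on the imaginary axis (phase side): for ℚ-free real r, trdeg ℚ(i r, e^(i r)) ≥ m
(exponentials on the unit circle). S ⟹ it by restriction to z = i r; m = 1 is Hermite–Lindemann; m =
2 at r = (1, π) reads e^i ⊥ π (open). [difficulty: open-problem] -/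
@[route_item "route-Schanuel-RootDecomp1C", crux (bottleneck := idea) (source := "ledger D-0171 leaf tag IDEA-NEEDED on stmt-Schanuel-24624, 2026-09-01")]
def UnitarySchanuel : Prop :=
  ∀ (m : ℕ) (r : Fin m → ℝ), LinearIndependent ℚ r → (m : Cardinal) ≤ Algebra.trdeg ℚ ↥(IntermediateField.adjoin ℚ (Set.range (fun j => ((r j : ℝ) : ℂ) * Complex.I) ∪ Set.range (Complex.exp ∘ fun j => ((r j : ℝ) : ℂ) * Complex.I)))

/-- item stmt-Schanuel-19278 · crux · leaf IDEA-NEEDED · rank 4 · open · by planner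
why it might fail: false iff some ℚ-free real tuple has trdeg ℚ(x, e^x) < n, e.g. e and e^e algebraically dependent; open since Lang 1966 (real case), no counterexample known.
sources: MacintyreWilkie1996, KirbyZilber2006, Waldschmidt2000, Lang1966
[crux] SC_ℝ, the Schanuel property of the real exponential field (sketch item X1): for ℚ-linearly
independent real a₁ … aₙ, trdeg_ℚ ℚ(a, e^a) ≥ n; verbatim the Literature def `SchanuelProperty ℝ`.
RESIDUAL conjunct: a consequence of S (tree `schanuelProperty_real_of_complex_holds`), imported
complement of X2, not attacked on this route. [difficulty: open-problem] -/
@[route_item "route-Schanuel-RootDecomp1C", crux (bottleneck := idea) (source := "ledger D-0171 leaf tag IDEA-NEEDED on stmt-Schanuel-19278, 2026-09-01")]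
def RealSchanuel : Prop :=
  Literature.ModelTheory.ExponentialFields.SchanuelProperty ℝ

/-- item stmt-Schanuel-24788 · support · rank 9 · closed · proved by Summit.Schanuel.Schanuel.Theorems.RootDecomp1CAxisReduction.axisReduction_holds (prover) · by planner
sources: Diaz1989, Waldschmidt2000
[support] SUPPORT BINDER (load-bearing; PROVABLE NOW — proved sorry-free in the lens file,
`schanuel_of_axisSchanuel`, ≈ 400 lines: σ = conj as a ℚ-algebra map,
`exists_axis_tuple_of_conj_stable` (a conj-stable finite-dimensional ℚ-subspace of ℂ is spanned by
an axis tuple), `Submodule.finrank_sup_add_finrank_inf_eq`, trdeg submodularity from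
`IntermediateField.lift_trdeg_add_eq` + base change): AxisSchanuel → Schanuel. It is the nontrivial
direction of the EQUIV layer; it closes when
HOME/decomp-schanuel-lens-6/ConjugationSymmetrisation.lean (sha256 5038e8d9…, namespace
Summit.Schanuel.Schanuel.Theorems.ConjugationSymmetrisation, rc 0, 0 sorry) is landed as
Summits/Schanuel/Schanuel/Theorems/ConjugationSymmetrisation.lean proving `theorem … :
RootDecomp1C.AxisReduction` (critic hygiene note 01:43:44Z: tag or inline the AxisSchanuel def there
to avoid the vendored-fact lint). S ⟹ AxisReduction trivially. TAG: support · leaf ATTACKABLE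
(landing task; it also yields RootDecomp1B's ConjStableReduction). [difficulty: provable-now] -/
@[route_item "route-Schanuel-RootDecomp1C", crux]
def AxisReduction : Prop :=
  AxisSchanuel → _root_.Schanuel

-- `AxisReduction` holds: proved by `Summit.Schanuel.Schanuel.Theorems.RootDecomp1CAxisReduction.axisReduction_holds` (its module imports this route file, so no `_holds` link can be stated here).

/-- item stmt-Schanuel-24789 · assembly · rank 1 · open · by planner
sources: Diaz1989, Waldschmidt2000
[assembly] AxisReduction → RealSchanuel → UnitarySchanuel → MixedInductionStep → Schanuel (pure
logic + linear algebra of re/im + the E-field embedding). -/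
@[route_item "route-Schanuel-RootDecomp1C"]
def Assembly : Prop :=
  AxisReduction → RealSchanuel → UnitarySchanuel → MixedInductionStep → _root_.Schanuel

/-! D-0027 §2.1 — DECIDING THEOREM (planner-authored via `route open/edit --closes-file`; by planner-decomp-schanuel-writer-1-g0-0 2026-08-30T02:03:29Z):
its hypotheses are this route's items and its conclusion the sub-problem Statement (glue_lint), and it elaborates with this file. -/

@[closes "route-Schanuel-RootDecomp1C"] theorem closes (hAx : AxisReduction) (hR : RealSchanuel) (hU : UnitarySchanuel) (hM : MixedInductionStep) :
    _root_.Schanuel := by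
  classical
  -- piece 1 transported into ℂ along the E-field embedding ℝ ↪ ℂ
  have hRealC : ∀ (m : ℕ) (r : Fin m → ℝ), LinearIndependent ℚ r →
      (m : Cardinal) ≤ Algebra.trdeg ℚ ↥(IntermediateField.adjoin ℚ
        (Set.range (fun j => ((r j : ℝ) : ℂ)) ∪ Set.range (Complex.exp ∘ fun j => ((r j : ℝ) : ℂ)))) := by
    intro m r hr
    have h1 := hR m r hr
    have h2 :=
      Literature.ModelTheory.ExponentialFields.ExponentialRingHom.realComplex.lift_trdeg_adjoin_eq r
    simp only [Cardinal.lift_id] at h2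
    rw [h2] at h1
    exact h1
  -- the ℚ-linear maps r ↦ (r : ℂ) and r ↦ (r : ℂ) * I
  let ofRealQ : ℝ →ₗ[ℚ] ℂ :=
    Literature.ModelTheory.ExponentialFields.ExponentialRingHom.realComplex.toRingHom.toRatAlgHom.toLinearMap
  have ofRealQ_apply : ∀ t : ℝ, ofRealQ t = (t : ℂ) := fun t => rfl
  let mulIQ : ℝ →ₗ[ℚ] ℂ := (LinearMap.mulRight ℚ Complex.I).comp ofRealQ
  have mulIQ_apply : ∀ t : ℝ, mulIQ t = (t : ℂ) * Complex.I := fun t => rfl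
  -- the three pieces give Schanuel for axis tuples, by strong induction on the length
  have hAxis : AxisSchanuel := by
    intro n
    induction n using Nat.strong_induction_on with
    | _ n ih =>
    intro z haxis hz
    by_cases hreal : ∀ j, (z j).im = 0
    · -- a real tuple
      let a : Fin n → ℝ := fun j => (z j).re
      have hz_eq : z = fun j => ((a j : ℝ) : ℂ) := by
        funext j
        apply Complex.ext
        · simp [a]
        · simp [a, hreal j]
      have hali : LinearIndependent ℚ a := by
        have hcomp : (⇑ofRealQ ∘ a) = z := by
          funext j; rw [hz_eq]; rfl
        refine LinearIndependent.of_comp ofRealQ ?_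
        rw [hcomp]; exact hz
      rw [hz_eq]
      exact hRealC n a hali
    · push_neg at hreal
      by_cases himag : ∀ j, (z j).re = 0
      · -- a purely imaginary tuple: z j = (b j : ℂ) * I with b j = Im (z j)
        let b : Fin n → ℝ := fun j => (z j).im
        have hz_eq : z = fun j => ((b j : ℝ) : ℂ) * Complex.I := by
          funext j
          apply Complex.ext
          · simp [b, himag j]
          · simp [b]
        have hbli : LinearIndependent ℚ b := by
          have hcomp : (⇑mulIQ ∘ b) = z := by
            funext j; rw [hz_eq]; rfl
          refine LinearIndependent.of_comp mulIQ ?_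
          rw [hcomp]; exact hz
        rw [hz_eq]
        exact hU n b hbli
      · push_neg at himag
        exact hM n z haxis hreal himag (fun m w hm hw hwli => ih m hm w hw hwli) hz
  exact hAx hAxis

end Summit.Schanuel.Schanuel.Theses.RootDecomp1C
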